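import Literature.NumberTheory.Transcendental.NesterenkoFormsOnHyperplanesK
import HarnessLib

/-!
# The norm of a form over a completely split form (towards LNM 1752 Ch. 3 Prop. 4.11, route B) — proofs and one plumbing definition

`Literature/NumberTheory/Transcendental/NesterenkoSplitNorm.lean`. Towards the discharge of the
named fact `NesterenkoPhilippon2001_ch3_prop_4_11` (Nesterenko–Philippon (eds.), LNM 1752 (2001),
Ch. 3 Prop. 4.11 = [Nes10, Prop. 1.4], the Bézout step of Nesterenko's elimination method) by the
*specialisation route*: the associated form `F(u₁, …, u_r)` of the prime `𝔭`, read as a form in the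
last group `u_r` over an algebraically closed field `Ω` containing `ℚ(u₁, …, u_{r−1})` (or over `ℂ`
after specialising `u₁, …, u_{r−1}`), SPLITS into linear forms,
`F = c · ∏_{i<D} (β⁽ⁱ⁾ · u_r)` (`β⁽ⁱ⁾` the points of `V(𝔭)` on the hyperplanes `u₁, …, u_{r−1}`;
`NesterenkoEliminationZerosK.lean` + `NesterenkoFormsOnHyperplanesK.lean`), and the `u`-resultant of
`F` with a form `Q` of degree `d` is the number

  `N_Q(c, β) = c^d · ∏_{i<D} Q(β⁽ⁱ⁾)`   (`splitNorm`).

This file isolates the purely algebraic facts about this expression over an arbitrary field `K`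
(for `Q` with INTEGER coefficients, so that everything commutes with arbitrary ring homomorphisms —
reductions modulo valuation ideals included):

* `aeval_smul_of_isHomogeneous_int` — `Q(λ β) = λ^d Q(β)`;
* `splitNorm_eq_of_eq` — **well-definedness**: two splittings `c ∏ (β⁽ⁱ⁾·u) = c' ∏ (β'⁽ⁱ⁾·u) ≠ 0` of
  the same form give the same `N_Q` (unique factorisation in `K[u₀, …, u_m]`: the linear forms are
  prime, so the `β'` are a permutation of non-zero multiples `λᵢ β⁽ⁱ⁾`, and `c' = c / ∏ λᵢ`);
* `map_splitNorm`, `map_C_mul_prod_lin` — functoriality in ring homomorphisms `K → L`;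
* `splitNorm_smul_left` — `N_Q(a c, β) = a^d N_Q(c, β)`.

No named facts; the only definition is the plumbing `splitNorm` (with body).

## References

* [NesterenkoPhilippon2001] Yu. V. Nesterenko, P. Philippon (eds.), *Introduction to Algebraic
  Independence Theory*, LNM 1752, Springer 2001, Ch. 3 §4, Prop. 4.11 (pp. 40–41; PDF pp. 52–53).
* [Nes10] Yu. V. Nesterenko, Proc. Steklov Inst. Math. 218 (1997) 294–331, Prop. 1.4 (the
  resultant `a^{deg Q} ∏ Q(β⁽ᵏ⁾)`).
* [HodgePedoe1994] W. V. D. Hodge, D. Pedoe, *Methods of Algebraic Geometry* II, Ch. X §§6–8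
  (the Cayley form splits into linear factors over the generic linear section).
-/

noncomputable section

open MvPolynomial

namespace Literature.NumberTheory.Transcendental

namespace Nesterenko

variable {K : Type*} [Field K] {m : ℕ}

/-! ### Integer forms at proportional points -/

/-- `Q(λ β) = λ^d Q(β)` for an integer form `Q` of degree `d`, in any commutative ring. [folklore] -/
theorem aeval_smul_of_isHomogeneous_int {S : Type*} [CommRing S]
    {Q : MvPolynomial (Fin (m + 1)) ℤ} {d : ℕ} (hQ : Q.IsHomogeneous d) (c : S)
    (β : Fin (m + 1) → S) : aeval (c • β) Q = c ^ d * aeval β Q := by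
  classical
  rw [aeval_def, aeval_def, eval₂_eq', eval₂_eq', Finset.mul_sum]
  refine Finset.sum_congr rfl fun s hs => ?_
  have hsd : ∑ i, s i = d := by
    have h := hQ (mem_support_iff.1 hs)
    rw [Finsupp.weight_apply, Finsupp.sum_fintype _ _ (fun i => by simp)] at h
    simpa using h
  simp only [Pi.smul_apply, smul_eq_mul, mul_pow, Finset.prod_mul_distrib,
    Finset.prod_pow_eq_pow_sum, hsd]
  ring

/-- Integer polynomials commute with ring homomorphisms: `φ (Q(β)) = Q(φ ∘ β)`. [folklore] -/
theorem map_aeval_int {S T : Type*} [CommRing S] [CommRing T] (φ : S →+* T)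
    (Q : MvPolynomial (Fin (m + 1)) ℤ) (β : Fin (m + 1) → S) :
    φ (aeval β Q) = aeval (fun j => φ (β j)) Q := by
  rw [aeval_def, aeval_def]
  refine (eval₂_comp_left φ (algebraMap ℤ S) β Q).trans ?_
  congr 1
  exact RingHom.ext_int _ _

/-! ### The split norm -/

/-- **The norm of `Q` over a split form.** For a splitting datum `(c, β)` — a constant `c` and `D`
coefficient vectors `β⁽ⁱ⁾ ∈ K^{m+1}` of linear forms — and an integer form `Q` of degree `d`:
`N_Q(c, β) = c^d ∏_{i<D} Q(β⁽ⁱ⁾)`. When `c ∏ (β⁽ⁱ⁾ · u)` is the associated form of a prime `𝔭`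
read over the generic linear section, this is Nesterenko's resultant of `𝔭` and `Q`.
[cite: NesterenkoPhilippon2001, Ch. 3 Prop. 4.11 (pp. 40–41)] -/
def splitNorm (d : ℕ) (Q : MvPolynomial (Fin (m + 1)) ℤ) (c : K) {D : ℕ}
    (β : Fin D → Fin (m + 1) → K) : K :=
  c ^ d * ∏ i, aeval (β i) Q

/-- Unfolding `splitNorm`. [folklore] -/
theorem splitNorm_def (d : ℕ) (Q : MvPolynomial (Fin (m + 1)) ℤ) (c : K) {D : ℕ}
    (β : Fin D → Fin (m + 1) → K) : splitNorm d Q c β = c ^ d * ∏ i, aeval (β i) Q := rfl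

/-- `N_Q(a c, β) = a^d N_Q(c, β)`. [folklore] -/
theorem splitNorm_smul_left (d : ℕ) (Q : MvPolynomial (Fin (m + 1)) ℤ) (a c : K) {D : ℕ}
    (β : Fin D → Fin (m + 1) → K) : splitNorm d Q (a * c) β = a ^ d * splitNorm d Q c β := by
  rw [splitNorm, splitNorm, mul_pow, mul_assoc]

/-- Rescaling one vector: `N_Q(c, …, λ β⁽ⁱ⁾, …) = λ^d N_Q(c, β)` — so that `N_Q` only depends on
`c ∏ᵢ λᵢ⁻¹` and the lines `[β⁽ⁱ⁾]`. [folklore] -/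
theorem splitNorm_update_smul {d : ℕ} {Q : MvPolynomial (Fin (m + 1)) ℤ} (hQ : Q.IsHomogeneous d)
    (c : K) {D : ℕ} (β : Fin D → Fin (m + 1) → K) (i : Fin D) (a : K) :
    splitNorm d Q c (Function.update β i (a • β i)) = a ^ d * splitNorm d Q c β := by
  classical
  rw [splitNorm, splitNorm, ← Finset.mul_prod_erase _ _ (Finset.mem_univ i),
    ← Finset.mul_prod_erase Finset.univ (fun j => aeval (β j) Q) (Finset.mem_univ i),
    Function.update_self, aeval_smul_of_isHomogeneous_int hQ]
  have h : ∏ j ∈ Finset.univ.erase i, aeval (Function.update β i (a • β i) j) Q =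
      ∏ j ∈ Finset.univ.erase i, aeval (β j) Q :=
    Finset.prod_congr rfl fun j hj => by rw [Function.update_of_ne (Finset.ne_of_mem_erase hj)]
  rw [h]
  ring

/-! ### Functoriality -/

/-- A ring homomorphism maps `c ∏ (β⁽ⁱ⁾ · u)` to `φ(c) ∏ (φβ⁽ⁱ⁾ · u)`. [folklore] -/
theorem map_C_mul_prod_lin {L : Type*} [CommRing L] (φ : K →+* L) (c : K) {D : ℕ}
    (β : Fin D → Fin (m + 1) → K) :
    MvPolynomial.map φ (C c * ∏ i, (∑ j, C (β i j) * X j)) =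
      C (φ c) * ∏ i, (∑ j, C (φ (β i j)) * X j : MvPolynomial (Fin (m + 1)) L) := by
  simp [map_prod, map_sum]

/-- A ring homomorphism maps `N_Q(c, β)` to `N_Q(φ c, φ ∘ β)`. [folklore] -/
theorem map_splitNorm {L : Type*} [Field L] (φ : K →+* L) (d : ℕ)
    (Q : MvPolynomial (Fin (m + 1)) ℤ) (c : K) {D : ℕ} (β : Fin D → Fin (m + 1) → K) :
    φ (splitNorm d Q c β) = splitNorm d Q (φ c) (fun i j => φ (β i j)) := by
  rw [splitNorm, splitNorm, map_mul, map_pow, map_prod]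
  congr 1
  exact Finset.prod_congr rfl fun i _ => map_aeval_int φ Q (β i)

/-! ### Well-definedness: independence of the splitting -/

/-- The degree count: if `c ∏_{i<D} (β⁽ⁱ⁾ · u) = c' ∏_{i<D'} (β'⁽ⁱ⁾ · u)` with `c ≠ 0` and all
vectors non-zero, then `D = D'`. [folklore] -/
theorem eq_of_C_mul_prod_lin_eq {c c' : K} {D D' : ℕ} {β : Fin D → Fin (m + 1) → K}
    {β' : Fin D' → Fin (m + 1) → K} (hβ : ∀ i, β i ≠ 0) (hc : c ≠ 0)
    (h : C c * ∏ i, (∑ j, C (β i j) * X j) =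
      (C c' * ∏ i, (∑ j, C (β' i j) * X j) : MvPolynomial (Fin (m + 1)) K)) : D = D' := by
  have hne : (C c * ∏ i, (∑ j, C (β i j) * X j) : MvPolynomial (Fin (m + 1)) K) ≠ 0 :=
    mul_ne_zero (by rwa [Ne, C_eq_zero]) (Finset.prod_ne_zero_iff.mpr fun i _ => linK_ne_zero (hβ i))
  have hc' : c' ≠ 0 := by
    rintro rfl
    exact hne (by rw [h, C_0, zero_mul])
  have hne' : (C c' * ∏ i, (∑ j, C (β' i j) * X j) : MvPolynomial (Fin (m + 1)) K) ≠ 0 := h ▸ hne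
  have hD : (C c * ∏ i, (∑ j, C (β i j) * X j) : MvPolynomial (Fin (m + 1)) K).IsHomogeneous D := by
    have := (IsHomogeneous.prod Finset.univ (fun i => (∑ j, C (β i j) * X j :
      MvPolynomial (Fin (m + 1)) K)) (fun _ => 1) fun i _ => isHomogeneous_linK (β i)).C_mul c
    simpa using this
  have hD' : (C c' * ∏ i, (∑ j, C (β' i j) * X j) : MvPolynomial (Fin (m + 1)) K).IsHomogeneous D' := by
    have := (IsHomogeneous.prod Finset.univ (fun i => (∑ j, C (β' i j) * X j :
      MvPolynomial (Fin (m + 1)) K)) (fun _ => 1) fun i _ => isHomogeneous_linK (β' i)).C_mul c'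
    simpa using this
  have h1 := hD.totalDegree hne
  have h2 := hD'.totalDegree hne'
  rw [h] at h1
  exact h1.symm.trans h2

/-- **Well-definedness of the split norm.** If `c ∏_{i<D} (β⁽ⁱ⁾ · u) = c' ∏_{i<D'} (β'⁽ⁱ⁾ · u)` in
`K[u₀, …, u_m]` with `c ≠ 0` and all the vectors non-zero, then `c^d ∏ Q(β⁽ⁱ⁾) = c'^d ∏ Q(β'⁽ⁱ⁾)`
for every integer form `Q` of degree `d`. (Unique factorisation: the linear forms `β · u` are prime,
so the `β'⁽ⁱ⁾` are, up to order, non-zero multiples `λᵢ β⁽ⁱ⁾`, and `c' = c ∏ λᵢ⁻¹`.) [folklore] -/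
theorem splitNorm_eq_of_eq {d : ℕ} {Q : MvPolynomial (Fin (m + 1)) ℤ} (hQ : Q.IsHomogeneous d) :
    ∀ {D D' : ℕ} {c c' : K} {β : Fin D → Fin (m + 1) → K} {β' : Fin D' → Fin (m + 1) → K},
      (∀ i, β i ≠ 0) → (∀ i, β' i ≠ 0) → c ≠ 0 →
      C c * ∏ i, (∑ j, C (β i j) * X j) =
        (C c' * ∏ i, (∑ j, C (β' i j) * X j) : MvPolynomial (Fin (m + 1)) K) →
      splitNorm d Q c β = splitNorm d Q c' β' := by
  intro D
  induction D with
  | zero =>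
    intro D' c c' β β' hβ hβ' hc h
    have hDD' := eq_of_C_mul_prod_lin_eq hβ hc h
    subst hDD'
    simp only [Finset.univ_eq_empty, Finset.prod_empty, mul_one, C_inj] at h
    subst h
    simp [splitNorm]
  | succ k ih =>
    intro D' c c' β β' hβ hβ' hc h
    -- `ℓ₀ = β 0 · u` is prime and divides the right-hand side
    have hprime := prime_linK (hβ 0)
    have hdvd : ((∑ j, C (β 0 j) * X j) : MvPolynomial (Fin (m + 1)) K) ∣
        C c' * ∏ i, (∑ j, C (β' i j) * X j) := by
      rw [← h, Fin.prod_univ_succ]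
      exact ⟨C c * ∏ i : Fin k, (∑ j, C (β (Fin.succ i) j) * X j), by ring⟩
    have hc' : c' ≠ 0 := by
      rintro rfl
      have hne : (C c * ∏ i, (∑ j, C (β i j) * X j) : MvPolynomial (Fin (m + 1)) K) ≠ 0 :=
        mul_ne_zero (by rwa [Ne, C_eq_zero])
          (Finset.prod_ne_zero_iff.mpr fun i _ => linK_ne_zero (hβ i))
      exact hne (by rw [h, C_0, zero_mul])
    have hdvd' : ((∑ j, C (β 0 j) * X j) : MvPolynomial (Fin (m + 1)) K) ∣
        ∏ i, (∑ j, C (β' i j) * X j) := by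
      rcases hprime.dvd_or_dvd hdvd with h1 | h1
      · exfalso
        exact hprime.not_unit (isUnit_of_dvd_unit h1 ((IsUnit.mk0 c' hc').map C))
      · exact h1
    obtain ⟨j₀, -, hj₀⟩ := (hprime.dvd_finsetProd_iff _).mp hdvd'
    obtain ⟨a, ha⟩ := eq_smul_of_linK_dvd_linK (hβ 0) (hβ' j₀) hj₀
    have ha0 : a ≠ 0 := by
      rintro rfl
      exact hβ' j₀ (by rw [ha, zero_smul])
    -- peel `β 0` on the left and `β' j₀` on the right
    obtain ⟨k', rfl⟩ : ∃ k', D' = k' + 1 := ⟨D' - 1, by have := j₀.pos; omega⟩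
    have hsplit : C c * ∏ i : Fin k, (∑ j, C (β (Fin.succ i) j) * X j) =
        (C (c' * a) * ∏ i : Fin k', (∑ j, C (β' (j₀.succAbove i) j) * X j) :
          MvPolynomial (Fin (m + 1)) K) := by
      have hl : ((∑ j, C (β' j₀ j) * X j) : MvPolynomial (Fin (m + 1)) K) =
          C a * (∑ j, C (β 0 j) * X j) := by rw [ha, linK_smul]
      have e := h
      rw [Fin.prod_univ_succ, Fin.prod_univ_succAbove _ j₀, hl] at e
      have e' : ((∑ j, C (β 0 j) * X j) : MvPolynomial (Fin (m + 1)) K) *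
          (C c * ∏ i : Fin k, (∑ j, C (β (Fin.succ i) j) * X j)) =
          (∑ j, C (β 0 j) * X j) *
            (C (c' * a) * ∏ i : Fin k', (∑ j, C (β' (j₀.succAbove i) j) * X j)) := by
        rw [map_mul]
        calc _ = C c * ((∑ j, C (β 0 j) * X j) * ∏ i : Fin k, (∑ j, C (β (Fin.succ i) j) * X j)) := by
              ring
          _ = C c' * (C a * (∑ j, C (β 0 j) * X j) *
                ∏ i : Fin k', (∑ j, C (β' (j₀.succAbove i) j) * X j)) := e
          _ = _ := by ring
      exact mul_left_cancel₀ (linK_ne_zero (hβ 0)) e'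
    have hih := ih (fun i => hβ (Fin.succ i)) (fun i => hβ' (j₀.succAbove i)) hc hsplit
    -- reassemble
    rw [splitNorm, splitNorm] at hih ⊢
    rw [Fin.prod_univ_succ, Fin.prod_univ_succAbove _ j₀, ha, aeval_smul_of_isHomogeneous_int hQ]
    calc c ^ d * (aeval (β 0) Q * ∏ i : Fin k, aeval (β (Fin.succ i)) Q)
        = aeval (β 0) Q * (c ^ d * ∏ i : Fin k, aeval (β (Fin.succ i)) Q) := by ring
      _ = aeval (β 0) Q * ((c' * a) ^ d * ∏ i : Fin k', aeval (β' (j₀.succAbove i)) Q) := by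
          rw [hih]
      _ = c' ^ d * (a ^ d * aeval (β 0) Q * ∏ i : Fin k', aeval (β' (j₀.succAbove i)) Q) := by
          ring

/-- The split norm of a datum is non-zero iff `c ≠ 0` and no `Q(β⁽ⁱ⁾)` vanishes. [folklore] -/
theorem splitNorm_ne_zero_iff {d : ℕ} (hd : 0 < d) (Q : MvPolynomial (Fin (m + 1)) ℤ) (c : K)
    {D : ℕ} (β : Fin D → Fin (m + 1) → K) :
    splitNorm d Q c β ≠ 0 ↔ c ≠ 0 ∧ ∀ i, aeval (β i) Q ≠ 0 := by
  rw [splitNorm, mul_ne_zero_iff, pow_ne_zero_iff hd.ne', Finset.prod_ne_zero_iff]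
  simp

end Nesterenko

end Literature.NumberTheory.Transcendental

end
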